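import Literature.IUT.HodgeArakelov.AbsTopInterfacesLogShellProofs
import Literature.IUT.HodgeArakelov.AbsTopMonoidsGenuineIsometries

/-!
# [IUTchII] §1, Example 1.8 (ix) × (iv): print's `Ism(G)` and the GENUINE producer preserve the log-shell — PROOFS

Proof-only sequel (abc-iut cell, block C / wave W6 cone prover abc-iut-w6-d013; node **IUTchII:Ex1.8(ix)**) of
`AbsTopInterfacesLogShellProofs.lean` (p427938: the log-shell `I(G) ⊆ O^{×μ}(G)` of abc-iut-L6-t1's interface
`AbsTopMonoids`, [IUTchII] Ex. 1.8 (ix) p. 41, is carried onto itself by every lattice-preserving automorphism, in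
particular by every element of abc-iut-L6-t2's `isometryGroup (A.actOunits G) 𝓗` with `⊤ ∈ 𝓗`) and of
abc-iut-L6-d2's `AbsTopMonoidsGenuineIsometries.lean` (p427597: print's `Ism(G)` as `AbsTopMonoids.ism A G :=
isometryGroup (A.actOunits G) (openSubgroups G)`, the re-packaging `withIsometries`, and the GENUINE producer
`genuineOfModelIsm` whose `Ism`-side is print's isometry group with `Ẑ^× ↠ ℤ_p^× ↪ Ism(G)`).  NO new definitions.

Source: S. Mochizuki, *Inter-universal Teichmüller theory II*, §1, kurims manuscript (Dec. 2020): Example 1.8 (iv)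
p. 39 ("`Ism(G)` … `G`-equivariant automorphisms of … `O^{×μ}(G)` that, for each open subgroup `H ⊆ G`, preserve the
lattice … determined by the image of `O^×(G)^H` … `Γ^{×μ} ⊆ Ism(−)` … another example of such a `Γ^{×μ}` is the
image `Im(Ẑ^×)` of the natural homomorphism `Ẑ^× ↠ ℤ_p^× ↪ Ism`") and Example 1.8 (ix) p. 41 ("one verifies
immediately that one obtains a log-shell version of the multiradial environments constructed in (v), (vi), and
(viii)" — whose coric isomorphisms are `Γ^{×μ}`-multiples of induced isomorphisms).  Claim key `Mochizuki2012`,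
status DISPUTED (D-0012); record-only, no side taken on [IUTchIII] Cor. 3.12.

What is PROVED (the `Γ^{×μ} ⊆ Ism`-part of "one verifies immediately", now for print's `Ism(G)` itself and at the
genuine model, complementing the interface-level transport/invariance of p427938):
* `top_mem_openSubgroups`: `G` itself is an open subgroup, so `image_logShell_of_mem_ism`: EVERY element of print's
  `Ism(G) = A.ism G` carries `I(G)` onto itself (any `A : AbsTopMonoids S`);
* for the re-packaging `A.withIsometries z hz` (`Ism := ism`, tautological action): the log-shell is that of `A`
  (`withIsometries_logShell`, `rfl`) and is preserved by `actIsm G φ` for every `φ : Ism(G)` and by the given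
  `Ẑ^×`-action `z G u = actIsm G (toIsm G u)` (`image_logShell_withIsometries_actIsm`, `image_logShell_of_toIsm_hyp`);
* at abc-iut-L6-d2's GENUINE producer `genuineOfModelIsm S C ε hΔ hq` (`O^⊳(G) = 𝒪_k̄^⊳`, `Ism(G)` = print's
  isometry group, `Ẑ^×` acting through the `p`-adic cyclotomic character): `actIsm G φ` and `actIsm G (toIsm G u)`
  carry the genuine log-shell onto itself (`image_logShell_genuineOfModelIsm_actIsm`, `…_actIsm_toIsm`).
Together with p427938's `image_logShell_mapOtri` (valid for every `A`, in particular the genuine producer), the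
coric isomorphisms of the log-shell versions of (v), (vi), (viii) respect the log-shells at the genuine model.
-/

set_option autoImplicit false

namespace Literature.IUT.HodgeArakelov

namespace AbsTopMonoids

open CategoryTheory

/-! ### Print's `Ism(G)` preserves the log-shell (any interface datum `A`) -/

section Generic

universe u

variable {S : ThetaSetting.{u}} (A : AbsTopMonoids S)

/-- `G` itself is an open subgroup of `G` (the index `H = G` of "for each open subgroup `H ⊆ G`", p. 39).
[claim: Mochizuki2012, status: disputed] (IUTchII §1 Ex 1.8 (iv), kurims p.39) -/
theorem top_mem_openSubgroups (G : IsoClass S.Gk) : (⊤ : Subgroup G.G) ∈ openSubgroups G :=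
  isOpen_univ

/-- Every `G`-isometry in print's sense (`φ ∈ Ism(G) = A.ism G`) identifies membership in the log-shell `I(G)` before
and after. [claim: Mochizuki2012, status: disputed] (IUTchII §1 Ex 1.8 (ix), kurims p.41) -/
theorem mem_logShell_iff_of_mem_ism (G : IsoClass S.Gk) {φ : MulAut (A.Oxmu G)} (hφ : φ ∈ A.ism G)
    (y : A.Oxmu G) : φ y ∈ A.logShell G ↔ y ∈ A.logShell G :=
  A.mem_logShell_iff_of_map_invariantLattice G φ
    (((mem_isometryGroup _ _ φ).1 hφ).2 ⊤ (top_mem_openSubgroups G)) y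

/-- **Print's `Ism(G)` preserves the log-shell**: every `φ ∈ Ism(G) = A.ism G` carries `I(G)` onto itself.
[claim: Mochizuki2012, status: disputed] (IUTchII §1 Ex 1.8 (ix), kurims p.41) -/
theorem image_logShell_of_mem_ism (G : IsoClass S.Gk) {φ : MulAut (A.Oxmu G)} (hφ : φ ∈ A.ism G) :
    φ '' A.logShell G = A.logShell G :=
  A.image_logShell_of_mem_isometryGroup G (top_mem_openSubgroups G) hφ

variable (z : ∀ G : IsoClass S.Gk, ZHatUnits →* MulAut (A.Oxmu G))
  (hz : ∀ (G : IsoClass S.Gk) (u : ZHatUnits), z G u ∈ A.ism G)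

/-- The `G`-invariants `O^×(G)^G` of the re-packaged datum `A.withIsometries z hz` are those of `A` (the monoids and
actions are unchanged). [claim: Mochizuki2012, status: disputed] (IUTchII §1 Ex 1.8 (ix), kurims p.41) -/
theorem withIsometries_unitsInvariants (G : IsoClass S.Gk) :
    (A.withIsometries z hz).unitsInvariants G = A.unitsInvariants G := rfl

/-- The log-shell `I(G)` of the re-packaged datum `A.withIsometries z hz` is that of `A`.
[claim: Mochizuki2012, status: disputed] (IUTchII §1 Ex 1.8 (ix), kurims p.41) -/
theorem withIsometries_logShell (G : IsoClass S.Gk) :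
    (A.withIsometries z hz).logShell G = A.logShell G := rfl

/-- For the re-packaged datum (whose `Ism(G)` IS print's isometry group acting tautologically), `actIsm G φ` carries
the log-shell onto itself for every `φ : Ism(G)`.
[claim: Mochizuki2012, status: disputed] (IUTchII §1 Ex 1.8 (ix), kurims p.41) -/
theorem image_logShell_withIsometries_actIsm (G : IsoClass S.Gk) (φ : (A.withIsometries z hz).Ism G) :
    ((A.withIsometries z hz).actIsm G φ) '' (A.withIsometries z hz).logShell G =
      (A.withIsometries z hz).logShell G :=
  A.image_logShell_of_mem_ism G φ.2

/-- … in particular the `Ẑ^×`-action through `toIsm` (`= z`, "the image `Im(Ẑ^×)` of `Ẑ^× ↠ ℤ_p^× ↪ Ism`",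
p. 39) carries the log-shell onto itself. [claim: Mochizuki2012, status: disputed] (IUTchII §1 Ex 1.8 (ix), kurims p.41) -/
theorem image_logShell_withIsometries_actIsm_toIsm (G : IsoClass S.Gk) (u : ZHatUnits) :
    ((A.withIsometries z hz).actIsm G ((A.withIsometries z hz).toIsm G u)) '' (A.withIsometries z hz).logShell G =
      (A.withIsometries z hz).logShell G :=
  A.image_logShell_of_mem_ism G (hz G u)

end Generic

/-! ### At the GENUINE producer `genuineOfModelIsm` -/

section Producer

open Literature.AnabelianGeometry.AbsoluteAnabelian Genuine

variable (S : ThetaSetting.{0}) (C : MLFClosure.{0}) (ε : S.Gk ≃ₜ* (ModelMLFGaloisData.galois C.k C.K).tmPair.Pi)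
  (hΔ : ∀ f : S.PiX ≃ₜ* S.PiX, S.DeltaX.map f.toMulEquiv.toMonoidHom = S.DeltaX)
  (hq : Nonempty (TopGroup.quot S.PiX S.DeltaX ≃ₜ* S.Gk))

/-- The log-shell of the genuine producer with print's `Ism(G)` is that of abc-iut-L6-t13's `genuineOfModel` (same
monoids `O^⊳(G) = 𝒪_k̄^⊳` and actions). [claim: Mochizuki2012, status: disputed] (IUTchII §1 Ex 1.8 (ix), kurims p.41) -/
theorem genuineOfModelIsm_logShell (G : IsoClass S.Gk) :
    (genuineOfModelIsm S C ε hΔ hq).logShell G = (genuineOfModel S C ε hΔ hq).logShell G := rfl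

/-- **At the genuine model, every element of `Ism(G)` (print's isometry group of `G ↷ 𝒪_k̄^{×μ}`) carries the
log-shell `I(G)` onto itself.** [claim: Mochizuki2012, status: disputed] (IUTchII §1 Ex 1.8 (ix), kurims p.41) -/
theorem image_logShell_genuineOfModelIsm_actIsm (G : IsoClass S.Gk) (φ : (genuineOfModelIsm S C ε hΔ hq).Ism G) :
    ((genuineOfModelIsm S C ε hΔ hq).actIsm G φ) '' (genuineOfModelIsm S C ε hΔ hq).logShell G =
      (genuineOfModelIsm S C ε hΔ hq).logShell G :=
  (genuineOfModel S C ε hΔ hq).image_logShell_of_mem_ism G φ.2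

/-- **At the genuine model, `Ẑ^×` (acting through `Ẑ^× ↠ ℤ_p^× ↪ Ism(G)`, i.e. by `x ↦ x^{χ_p(u)}`) carries the
log-shell `I(G)` onto itself.** [claim: Mochizuki2012, status: disputed] (IUTchII §1 Ex 1.8 (ix), kurims p.41) -/
theorem image_logShell_genuineOfModelIsm_actIsm_toIsm (G : IsoClass S.Gk) (u : ZHatUnits) :
    ((genuineOfModelIsm S C ε hΔ hq).actIsm G ((genuineOfModelIsm S C ε hΔ hq).toIsm G u)) ''
        (genuineOfModelIsm S C ε hΔ hq).logShell G =
      (genuineOfModelIsm S C ε hΔ hq).logShell G :=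
  image_logShell_genuineOfModelIsm_actIsm S C ε hΔ hq G _

end Producer

end AbsTopMonoids

end Literature.IUT.HodgeArakelov
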